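import Summits.Ventures.HodgeRepro2.T6N43BergmanPlaces
import Summits.Ventures.HodgeRepro2.T6N43ExplicitToy

/-!
# T6N43BergmanToy — non-vacuity witnesses for the Bergman-explicit bundles (README §10.5(ii)(c)/(d))

The carriers `N43Places.BergmanU11` / `N43Places.BergmanPlaces` are inhabited, and the five remaining
binders of `BergmanPlaces.N43_places_bergman` (the displays `Hyp.EischenLiu2024_Sec2_2` ×3 and
`Hyp.Ruhl1970_A2f` ×2) hold JOINTLY on a toy: `N43Toy.bergmanU11` is the Cartan line of `toyU11`
(T6N43Toy.lean: `H = ℝ ∋ η`, `rep η = a_{η/2}`, Rühl's radial measure `½ sinh η dη` on η > 0, the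
Eischen–Liu L-factor of weight (0; 0), twist 0) with the forced-vector scalar `c = 1` — its Bergman datum
has, by construction, the coefficients `⟨π₃(a_{η/2})1, 1⟩₃ = cosh(η/2)^{−3}·π/2` (so (N4.3.P2) /
(N4.3.P2′) hold with no hypothesis, `BergmanU11.datum_*`), and the (A-2f) display transfers from
`toyU11_A2f` along the equal measure and matrix map (`ArchDoublingDatum.ruhl_A2f_of_eq`). The bundle
`N43Toy.bergmanToy : BergmanPlaces` (compact place `explicitU2` of T6N43ExplicitToy.lean) satisfies the
five binders at once (`bergman_binders_jointly_satisfiable`) and the theorem applies to it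
(`bergmanToy_archNonvanishing`). Axioms: {propext, Classical.choice, Quot.sound}. §8(d): uses an
L-value-free non-vanishing device: NO.
-/

namespace Summit.Ventures.HodgeRepro2.T6

open MeasureTheory

namespace N43Toy

/-- The Bergman-explicit toy at a (1,1)-place: `toyU11`'s Cartan line with the forced-vector scalar
`c = 1`. -/
noncomputable def bergmanU11 : N43Places.BergmanU11 where
  H := ℝ
  μ := toyU11.μ
  rep := toyU11.rep
  rep_mem := toyU11.rep_mem
  rep_measurable := toyU11.rep_measurable
  c := 1
  hc := one_ne_zero
  Lfac := toyU11.Lfac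
  τ := 0
  ν := 0
  r := 0

/-- The Bergman toy's datum has `toyU11`'s measure and matrix map. -/
theorem bergmanU11_datum_μ : bergmanU11.datum.μ = toyU11.μ := rfl

/-- `rep`. -/
theorem bergmanU11_datum_rep : bergmanU11.datum.rep = toyU11.rep := rfl

/-- The (A-2f) display on the Bergman toy, transferred from `toyU11_A2f`. -/
theorem bergmanU11_A2f : Hyp.Ruhl1970_A2f bergmanU11.datum :=
  ArchDoublingDatum.ruhl_A2f_of_eq rfl rfl toyU11_A2f

/-- The Eischen–Liu display on the Bergman toy: its L-factor is `toyU11`'s (weight (0; 0), twist 0). -/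
theorem bergmanU11_EL :
    Hyp.EischenLiu2024_Sec2_2 1 1 bergmanU11.τ bergmanU11.ν bergmanU11.r bergmanU11.Lfac :=
  fun _ => rfl

/-- The Bergman toy's coefficient on the forced vector is `cosh(η(g)/2)^{−3} · π/2` in modulus — the
explicit form of (N4.3.P2′) on the toy (`c = 1`, `‖f‖₃² = π/2`). -/
theorem bergmanU11_norm_coeffπ (g : ℝ) :
    ‖bergmanU11.datum.coeffπ g‖ =
      Real.pi / 2 * Real.cosh (bergmanU11.datum.eta g / 2) ^ (-3 : ℤ) := by
  rw [bergmanU11.datum_lowestWeightCoefficient g]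
  show (‖(1 : ℂ)‖ * Real.sqrt (Real.pi / 2)) ^ 2 * _ = _
  rw [norm_one, one_mul, Real.sq_sqrt (by positivity)]

/-- The Bergman-explicit toy bundle: the compact toy of T6N43ExplicitToy.lean at τ′₁, the Bergman toy
at τ′₂ and τ′₃. -/
noncomputable def bergmanToy : N43Places.BergmanPlaces where
  p₁ := explicitU2
  p₂ := bergmanU11
  p₃ := bergmanU11

/-- README §10.5(ii)(c)/(d) for `BergmanPlaces.N43_places_bergman`: the carrier is inhabited and its
five binders (displays only) are jointly satisfiable. -/
theorem bergman_binders_jointly_satisfiable :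
    ∃ X : N43Places.BergmanPlaces,
      Hyp.EischenLiu2024_Sec2_2 2 0 X.p₁.τ X.p₁.ν X.p₁.r X.p₁.Lfac ∧
      Hyp.Ruhl1970_A2f X.p₂.datum ∧
      Hyp.EischenLiu2024_Sec2_2 1 1 X.p₂.τ X.p₂.ν X.p₂.r X.p₂.Lfac ∧
      Hyp.Ruhl1970_A2f X.p₃.datum ∧
      Hyp.EischenLiu2024_Sec2_2 1 1 X.p₃.τ X.p₃.ν X.p₃.r X.p₃.Lfac :=
  ⟨bergmanToy, explicitU2_EL, bergmanU11_A2f, bergmanU11_EL, bergmanU11_A2f, bergmanU11_EL⟩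

/-- The theorem applied to the Bergman toy bundle. -/
theorem bergmanToy_archNonvanishing : bergmanToy.toPlaces.ArchNonvanishing :=
  bergmanToy.archNonvanishing_bergman explicitU2_EL bergmanU11_A2f bergmanU11_EL bergmanU11_A2f
    bergmanU11_EL

/-- The consumer theorem on the toy: `hx` is `rfl`. -/
theorem bergmanToy_binders :
    bergmanToy.toPlaces.d₁.CharacterCoefficient bergmanToy.toPlaces.m ∧
      bergmanToy.toPlaces.d₂.FockLineIdentification ∧
      bergmanToy.toPlaces.d₂.LowestWeightCoefficient ∧
      bergmanToy.toPlaces.d₃.FockLineIdentification ∧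
      bergmanToy.toPlaces.d₃.LowestWeightCoefficient :=
  bergmanToy.binders_of_eq _ rfl

end N43Toy

end Summit.Ventures.HodgeRepro2.T6
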